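import Mathlib
import HarnessLib
import Literature.Analysis.FluidPDE.VectorCalculus

/-!
# Crux idea «radial-jerk-tower» — typed sketch v1.1 (planner ns-idea-15 g7, lens «negation»; v1.1 = V21 prices paid, see Part C)

Crux: stmt-NavierStokesRegularity-1222 `…Theses.ThreadingFlux.PoloidalLiouville` (wall W1 = registered stub
`stub_scalarLiouville` of the antidynamo skeleton v2).  NS regularity is NOT proved; `PoloidalLiouville`,
`stub_scalarLiouville` and the local wall W2 (`…UnthreadedRigidityDoor.UnthreadedRigidity`, 27585) are OPEN;
nothing in this file proves or claims them.  Props + kernel-checked algebra only, no `sorry`.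

THE LEVER (Ertel's commutation).  For an ideal fluid `D_t(ω·∇θ) = ω·∇(D_t θ)` for EVERY scalar `θ`
([corpus:acheson1990 p.125, Ex. 5.17]; frozen-field form [corpus:majda2002 p.25–26, Prop. 1.8 / Lemma 1.4]).
Unthreadedness about `x₀` is `ω·∇θ₀ ≡ 0` for `θ₀ = ½‖x−x₀‖²`; hence the whole RADIAL-JERK TOWER
`θ_{k+1} := D_t θ_k` (θ₁ = ⟪v, x−x₀⟫ = loop momentum, θ₂ = ‖v‖² − ⟪x−x₀, ∇p⟫, …) consists of functions that are
CONSTANT ALONG VORTEX LINES.  Since `ω ≠ 0` spans a line, `rank(∇θ₀, ∇θ₁, ∇θ₂, …) ≤ 2` on `{ω ≠ 0}`: three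
functionally independent radial jerks kill every inviscid unthreaded configuration.  For Navier–Stokes the identity
acquires the explicit commutator `(D_t − νΔ)(ω·∇θ) = ω·∇((D_t − νΔ)θ) − 2ν ∇ω : ∇²θ`; level 1 stays clean
(`∇²θ₀ = I`, `div ω = 0` — this is the loop law of the lineage, g3), level ≥ 2 becomes differential in ω:
«viscosity relaxes algebraic rigidity into growth».

WHAT IS DECIDED (paper proofs in `Ideas/radial-jerk-tower.md`; algebraic cores kernel-checked below):
* INVISCID SHADOWS ARE ALGEBRAICALLY RIGID: a field frozen into ANY smooth drift `u` whose radial-jerk tower has rank 3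
  on a dense set cannot stay tangent to the spheres about `x₀` (`InviscidKinematicRigidity`); for the divergence-free
  triaxial strain `u = Sx` the three jerks are `‖x‖², xᵀSx, xᵀS²x` and the closure is the Vandermonde determinant
  (`vandermonde_closure`, kernel); the polhode loops of the Euler top (g5's object at a strain centre) thread at ORDER TWO
  with the universal rate `−4(a−b)(b−c)(c−a)·x₁x₂x₃` (`polhodeDefect_second_deriv`, kernel).
* THE VISCOUS STRAIN SHADOW IS COMPLETELY CLASSIFIED: every smooth solution of the passive viscous vector equation in the
  strain `Sx` that is tangent to the spheres on a connected open space-time set is `C·exp(xᵀSx/2ν)·(Sx × x)`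
  (`StrainShadowClassification`) — steady, non-axisymmetric, Gaussian-GROWING along every extensional principal axis;
  hence Liouville holds in the bounded class (`StrainShadowLiouville`) and boundedness is load-bearing already in the
  linear shadow (`StrainShadowSurvivor` = the `false-without-bounded` witness).  The survivor's algebraic skeleton is
  kernel-checked (`dTau_strain`, `survivor_balance`).
* NONLINEAR NECESSARY CONDITIONS: `InviscidRadialJerkTower` (all levels, Euler), `EulerRadialBernoulli` (level 2:
  `‖v‖² − ⟪x−x₀,∇p⟫` is constant on vortex lines), `ViscousLevelTwoLaw` (NS, with the commutator) — the closed-form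
  generator of the order-by-order threading laws of g3 (order one = level 1, order two = level 2 + commutator).
* TYPED TARGET (conjecture, quadratic level = `vandermonde_closure`): `PotentialJerkRigidity` — a harmonic background whose
  radial-jerk tower has rank ≤ 2 is axisymmetric about a line through `x₀`; with `InviscidKinematicRigidity` it decides the
  inviscid linearised local wall about every potential flow.
-/

set_option linter.dupNamespace false
set_option linter.unnecessarySeqFocus false

namespace Summit.NavierStokesRegularity.NavierStokesRegularity.Cruxes.PoloidalLiouville.ErtelTower

open scoped BigOperators Topology Classical InnerProductSpace RealInnerProductSpace
open Filter Set Function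

local notation "E" => EuclideanSpace ℝ (Fin 3)

/-! ## Part A — kernel-checked algebraic cores (principal-axis coordinates of a strain `S = diag(a,b,c)`)

Throughout Part A, `x₁ x₂ x₃` are the coordinates of `x − x₀` in a principal frame of the symmetric strain `S`,
`τ := Sx × x = ((b−c)x₂x₃, (c−a)x₃x₁, (a−b)x₁x₂)` is the Euler-top field (vortex lines = polhodes = sphere ∩ quadric),
and `ω = (ω₁, ω₂, ω₃)` is an arbitrary vector at `x`. -/

/-- `τ = Sx × x` is tangent to the spheres: `⟪τ, x⟫ = 0`. -/
theorem tau_perp_x (a b c x₁ x₂ x₃ : ℝ) :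
    (b - c) * x₂ * x₃ * x₁ + (c - a) * x₃ * x₁ * x₂ + (a - b) * x₁ * x₂ * x₃ = 0 := by ring

/-- `τ` passes level 1 of the tower in the strain (the loop law): `⟪τ, Sx⟫ = 0`. -/
theorem tau_perp_Sx (a b c x₁ x₂ x₃ : ℝ) :
    (b - c) * x₂ * x₃ * (a * x₁) + (c - a) * x₃ * x₁ * (b * x₂) + (a - b) * x₁ * x₂ * (c * x₃) = 0 := by ring

/-- Level 2 of the inviscid tower in the strain does NOT vanish: `⟪τ, S²x⟫ = −(a−b)(b−c)(c−a)·x₁x₂x₃`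
(the triaxiality discriminant times the octant coordinate). -/
theorem tau_dot_S2x (a b c x₁ x₂ x₃ : ℝ) :
    (b - c) * x₂ * x₃ * (a ^ 2 * x₁) + (c - a) * x₃ * x₁ * (b ^ 2 * x₂) + (a - b) * x₁ * x₂ * (c ^ 2 * x₃)
      = -((a - b) * (b - c) * (c - a)) * (x₁ * x₂ * x₃) := by ring

/-- VANDERMONDE CLOSURE (inviscid rigidity in a triaxial strain, pointwise core).  If the principal strains are
pairwise distinct and `x` lies off the principal planes, a vector orthogonal to the first three radial jerk gradients
`x, Sx, S²x` vanishes.  With Ertel's commutation (levels 0,1,2 of the tower) this is the whole proof of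
`InviscidStrainRigidity` below. -/
theorem vandermonde_closure (a b c x₁ x₂ x₃ ω₁ ω₂ ω₃ : ℝ)
    (hab : a ≠ b) (hbc : b ≠ c) (hca : c ≠ a) (hx₁ : x₁ ≠ 0) (hx₂ : x₂ ≠ 0) (hx₃ : x₃ ≠ 0)
    (h0 : ω₁ * x₁ + ω₂ * x₂ + ω₃ * x₃ = 0)
    (h1 : ω₁ * (a * x₁) + ω₂ * (b * x₂) + ω₃ * (c * x₃) = 0)
    (h2 : ω₁ * (a ^ 2 * x₁) + ω₂ * (b ^ 2 * x₂) + ω₃ * (c ^ 2 * x₃) = 0) :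
    ω₁ = 0 ∧ ω₂ = 0 ∧ ω₃ = 0 := by
  have e1 : (a - b) * (a - c) * (ω₁ * x₁) = 0 := by
    linear_combination h2 - (b + c) * h1 + (b * c) * h0
  have e2 : (b - a) * (b - c) * (ω₂ * x₂) = 0 := by
    linear_combination h2 - (a + c) * h1 + (a * c) * h0
  have e3 : (c - a) * (c - b) * (ω₃ * x₃) = 0 := by
    linear_combination h2 - (a + b) * h1 + (a * b) * h0
  have hab' : a - b ≠ 0 := sub_ne_zero.mpr hab
  have hba' : b - a ≠ 0 := sub_ne_zero.mpr (Ne.symm hab)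
  have hbc' : b - c ≠ 0 := sub_ne_zero.mpr hbc
  have hcb' : c - b ≠ 0 := sub_ne_zero.mpr (Ne.symm hbc)
  have hca' : c - a ≠ 0 := sub_ne_zero.mpr hca
  have hac' : a - c ≠ 0 := sub_ne_zero.mpr (Ne.symm hca)
  refine ⟨?_, ?_, ?_⟩
  · have : ω₁ * x₁ = 0 := by
      rcases mul_eq_zero.mp e1 with h | h
      · exact absurd h (mul_ne_zero hab' hac')
      · exact h
    rcases mul_eq_zero.mp this with h | h
    · exact h
    · exact absurd h hx₁
  · have : ω₂ * x₂ = 0 := by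
      rcases mul_eq_zero.mp e2 with h | h
      · exact absurd h (mul_ne_zero hba' hbc')
      · exact h
    rcases mul_eq_zero.mp this with h | h
    · exact h
    · exact absurd h hx₂
  · have : ω₃ * x₃ = 0 := by
      rcases mul_eq_zero.mp e3 with h | h
      · exact absurd h (mul_ne_zero hca' hcb')
      · exact h
    rcases mul_eq_zero.mp this with h | h
    · exact h
    · exact absurd h hx₃

/-- ORDER ONE of polhode threading vanishes identically (the loop law is passed): the coefficient
`a(b−c) + b(c−a) + c(a−b)` of the first time-derivative of the defect is `0`. -/
theorem polhode_order_one (a b c : ℝ) : a * (b - c) + b * (c - a) + c * (a - b) = 0 := by ring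

/-- ORDER TWO of polhode threading: the coefficient `a²(b−c) + b²(c−a) + c²(a−b)` equals minus the
triaxiality discriminant. -/
theorem polhode_order_two (a b c : ℝ) :
    a ^ 2 * (b - c) + b ^ 2 * (c - a) + c ^ 2 * (a - b) = -((a - b) * (b - c) * (c - a)) := by ring

/-- The CAUCHY (frozen-field) transport of `σ₀ τ` by the strain flow `x ↦ e^{tS}x` (tr S = 0) is, in principal
coordinates, `B(t,x) = σ₀(e^{−tS}x) · (e^{2at}(b−c)x₂x₃, e^{2bt}(c−a)x₃x₁, e^{2ct}(a−b)x₁x₂)`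
([corpus:majda2002 p.25, Prop. 1.8]); its radial defect factorises as `⟪B, x⟫ = σ₀(…)·x₁x₂x₃·F(t)` with the
universal profile `F` below.  (Pointwise algebra of the factorisation; `ea, eb, ec` stand for `e^{2at}, e^{2bt}, e^{2ct}`.) -/
theorem cauchy_defect_factorisation (a b c ea eb ec s x₁ x₂ x₃ : ℝ) :
    s * (ea * ((b - c) * x₂ * x₃)) * x₁ + s * (eb * ((c - a) * x₃ * x₁)) * x₂ + s * (ec * ((a - b) * x₁ * x₂)) * x₃
      = s * (x₁ * x₂ * x₃) * ((b - c) * ea + (c - a) * eb + (a - b) * ec) := by ring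

/-- The universal polhode-defect profile `F(t) = (b−c)e^{2at} + (c−a)e^{2bt} + (a−b)e^{2ct}`. -/
noncomputable def polhodeDefect (a b c : ℝ) (t : ℝ) : ℝ :=
  (b - c) * Real.exp (2 * a * t) + (c - a) * Real.exp (2 * b * t) + (a - b) * Real.exp (2 * c * t)

/-- Its first derivative. -/
noncomputable def polhodeDefect₁ (a b c : ℝ) (t : ℝ) : ℝ :=
  (b - c) * (2 * a) * Real.exp (2 * a * t) + (c - a) * (2 * b) * Real.exp (2 * b * t)
    + (a - b) * (2 * c) * Real.exp (2 * c * t)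

/-- Its second derivative. -/
noncomputable def polhodeDefect₂ (a b c : ℝ) (t : ℝ) : ℝ :=
  (b - c) * (2 * a) ^ 2 * Real.exp (2 * a * t) + (c - a) * (2 * b) ^ 2 * Real.exp (2 * b * t)
    + (a - b) * (2 * c) ^ 2 * Real.exp (2 * c * t)

private theorem hasDerivAt_exp_lin (k t : ℝ) :
    HasDerivAt (fun s => Real.exp (2 * k * s)) (2 * k * Real.exp (2 * k * t)) t := by
  have h : HasDerivAt (fun s => 2 * k * s) (2 * k) t := by
    simpa using (hasDerivAt_id t).const_mul (2 * k)
  have := h.exp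
  simpa [mul_comm] using this

theorem hasDerivAt_polhodeDefect (a b c t : ℝ) :
    HasDerivAt (polhodeDefect a b c) (polhodeDefect₁ a b c t) t := by
  have ha := (hasDerivAt_exp_lin a t).const_mul (b - c)
  have hb := (hasDerivAt_exp_lin b t).const_mul (c - a)
  have hc := (hasDerivAt_exp_lin c t).const_mul (a - b)
  have h : HasDerivAt (fun s => (b - c) * Real.exp (2 * a * s) + (c - a) * Real.exp (2 * b * s)
      + (a - b) * Real.exp (2 * c * s))
      ((b - c) * (2 * a * Real.exp (2 * a * t)) + (c - a) * (2 * b * Real.exp (2 * b * t))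
        + (a - b) * (2 * c * Real.exp (2 * c * t))) t := (ha.add hb).add hc
  refine h.congr_deriv ?_
  unfold polhodeDefect₁
  ring

theorem hasDerivAt_polhodeDefect₁ (a b c t : ℝ) :
    HasDerivAt (polhodeDefect₁ a b c) (polhodeDefect₂ a b c t) t := by
  have ha := (hasDerivAt_exp_lin a t).const_mul ((b - c) * (2 * a))
  have hb := (hasDerivAt_exp_lin b t).const_mul ((c - a) * (2 * b))
  have hc := (hasDerivAt_exp_lin c t).const_mul ((a - b) * (2 * c))
  have h : HasDerivAt (fun s => (b - c) * (2 * a) * Real.exp (2 * a * s)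
      + (c - a) * (2 * b) * Real.exp (2 * b * s) + (a - b) * (2 * c) * Real.exp (2 * c * s))
      ((b - c) * (2 * a) * (2 * a * Real.exp (2 * a * t)) + (c - a) * (2 * b) * (2 * b * Real.exp (2 * b * t))
        + (a - b) * (2 * c) * (2 * c * Real.exp (2 * c * t))) t := (ha.add hb).add hc
  refine h.congr_deriv ?_
  unfold polhodeDefect₂
  ring

/-- The defect and its first derivative vanish at `t = 0` (tangency at t = 0; loop law at order one) … -/
theorem polhodeDefect_zero (a b c : ℝ) : polhodeDefect a b c 0 = 0 ∧ polhodeDefect₁ a b c 0 = 0 := by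
  constructor <;> simp [polhodeDefect, polhodeDefect₁] <;> ring

/-- … and the second derivative at `t = 0` is `−4(a−b)(b−c)(c−a) ≠ 0` for pairwise distinct principal strains:
POLHODE LOOPS THREAD AT ORDER TWO under inviscid transport by their own strain, at a rate proportional to the
triaxiality discriminant (kernel form of the order-two threading found numerically on shells by g3). -/
theorem polhodeDefect_second_deriv (a b c : ℝ) :
    polhodeDefect₂ a b c 0 = -4 * ((a - b) * (b - c) * (c - a)) := by
  simp [polhodeDefect₂]; ring

theorem polhodeDefect_second_deriv_ne_zero (a b c : ℝ) (hab : a ≠ b) (hbc : b ≠ c) (hca : c ≠ a) :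
    polhodeDefect₂ a b c 0 ≠ 0 := by
  rw [polhodeDefect_second_deriv]
  have hab' : a - b ≠ 0 := sub_ne_zero.mpr hab
  have hbc' : b - c ≠ 0 := sub_ne_zero.mpr hbc
  have hca' : c - a ≠ 0 := sub_ne_zero.mpr hca
  have : (a - b) * (b - c) * (c - a) ≠ 0 := mul_ne_zero (mul_ne_zero hab' hbc') hca'
  intro h
  apply this
  linarith

/-! ### The viscous survivor `B⋆ = exp(xᵀSx/2ν)·(Sx × x)` — algebraic skeleton

`τ(x) = Sx × x` is a quadratic (bilinear-diagonal) field; its derivative at `x` in the direction `w` is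
`dτ(x)[w] = Sw × x + Sx × w`, written out below in principal coordinates.  The three calculus facts used in the card,
`(x·∇)τ = 2τ`, `(Sx·∇)τ = −Sτ` (needs `tr S = 0`) and — for `σ = exp(xᵀSx/2ν)` — `∇σ = (σ/ν)Sx`,
`Δσ = (σ/ν²)‖Sx‖²` (again `tr S = 0`), reduce the steady passive equation `−(Sx·∇)B + SB + νΔB = 0` for `B = στ`
to the identity `survivor_balance`. -/

/-- First component of `dτ(x)[w]`; the other two are its cyclic images. -/
def dTau₁ (b c x₂ x₃ w₂ w₃ : ℝ) : ℝ := (b - c) * (w₂ * x₃ + x₂ * w₃)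

/-- Euler homogeneity `(x·∇)τ = 2τ` (first component; cyclic). -/
theorem dTau_radial (b c x₂ x₃ : ℝ) : dTau₁ b c x₂ x₃ x₂ x₃ = 2 * ((b - c) * x₂ * x₃) := by
  unfold dTau₁; ring

/-- Strain transport of the top field: `(Sx·∇)τ = −Sτ` when `a + b + c = 0` (first component; cyclic). -/
theorem dTau_strain (a b c x₂ x₃ : ℝ) (htr : a + b + c = 0) :
    dTau₁ b c x₂ x₃ (b * x₂) (c * x₃) = -(a * ((b - c) * x₂ * x₃)) := by
  have hbc : b + c = -a := by linarith
  unfold dTau₁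
  have : (b - c) * (b * x₂ * x₃ + x₂ * (c * x₃)) = (b + c) * ((b - c) * x₂ * x₃) := by ring
  rw [this, hbc]; ring

/-- SURVIVOR BALANCE.  With `q = ‖Sx‖²`, `τ₁` a component of `τ`, `(Sτ)₁ = a τ₁` the same component of `Sτ`, and the
calculus facts above substituted (`∇σ = (σ/ν)Sx`, `Δσ = (σ/ν²)q`, `(Sx·∇)τ = −Sτ`, `Δτ = 0`), the steady passive
viscous equation `−[(Sx·∇σ)τ + σ(Sx·∇)τ] + σSτ + ν[(Δσ)τ + 2(∇σ·∇)τ + σΔτ] = 0` holds identically (after dividing by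
`σ > 0`).  This is the algebraic content of «`B⋆ = exp(xᵀSx/2ν)(Sx × x)` solves the linearised vorticity equation
about the strain `Sx`» (`StrainShadowSurvivor`). -/
theorem survivor_balance (ν q τ₁ a : ℝ) (hν : ν ≠ 0) :
    -((1 / ν) * q * τ₁ + (-(a * τ₁))) + a * τ₁ + ν * ((1 / ν ^ 2) * q * τ₁ + 2 * ((1 / ν) * (-(a * τ₁))) + 0) = 0 := by
  field_simp
  ring


/-! ## Part A2 — the objects on `EuclideanSpace ℝ (Fin 3)` and their kernel-checked pointwise identities -/

section Objects

/-- The RADIAL-JERK TOWER of a drift `u` about `x₀`: `θ 0 = ½‖x − x₀‖²`, `θ (k+1) = (∂ₜ + u·∇)(θ k)`.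
`θ 1 t x = ⟪u t x, x − x₀⟫` is the loop momentum of the lineage (g3) (`radialJerk_one`, kernel); on an Euler solution
`θ 2 = ‖u‖² − ⟪x − x₀, ∇p⟫` («radial Bernoulli function»); in a steady linear strain `u = Sx` (x₀ = 0) the tower is
`½‖x‖², xᵀSx, 2xᵀS²x, 4xᵀS³x, …` (`radialJerk_one_strain`, kernel). -/
noncomputable def radialJerk (u : ℝ → E → E) (x₀ : E) : ℕ → ℝ → E → ℝ
  | 0 => fun _ x => ‖x - x₀‖ ^ 2 / 2
  | k + 1 => fun t x =>
      deriv (fun s => radialJerk u x₀ k s x) t + inner ℝ (u t x) (gradient (radialJerk u x₀ k t) x)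

/-- The diagonal strain drift `x ↦ Sx`, `S = diag(a,b,c)` in the standard frame (every symmetric `S` after a rotation;
centre `x₀ = 0` after a translation). -/
noncomputable def strain (a b c : ℝ) (x : E) : E :=
  WithLp.toLp 2 ![a * x 0, b * x 1, c * x 2]

/-- The Euler-top field `τ(x) = Sx × x` (its integral curves on each sphere are the polhodes `sphere ∩ {xᵀSx = const}`). -/
noncomputable def topField (a b c : ℝ) (x : E) : E :=
  WithLp.toLp 2 ![(b - c) * x 1 * x 2, (c - a) * x 2 * x 0, (a - b) * x 0 * x 1]

/-- The quadratic form `xᵀSx`. -/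
noncomputable def quadForm (a b c : ℝ) (x : E) : ℝ :=
  a * (x 0) ^ 2 + b * (x 1) ^ 2 + c * (x 2) ^ 2

/-- KERNEL: `∇(½‖x − x₀‖²) = x − x₀` (level 0 of the tower has gradient the position vector). -/
theorem gradient_radial (x₀ x : E) : gradient (fun y : E => ‖y - x₀‖ ^ 2 / 2) x = x - x₀ := by
  have h1 : HasFDerivAt (fun y : E => y - x₀) (ContinuousLinearMap.id ℝ E) x :=
    (hasFDerivAt_id x).sub_const x₀
  have h2 : HasFDerivAt (fun y : E => ‖y - x₀‖ ^ 2)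
      ((2 : ℕ) • (innerSL ℝ (x - x₀)).comp (ContinuousLinearMap.id ℝ E)) x := h1.norm_sq
  have h3 := h2.const_mul (1 / 2 : ℝ)
  have h4 : HasFDerivAt (fun y : E => ‖y - x₀‖ ^ 2 / 2)
      ((1 / 2 : ℝ) • ((2 : ℕ) • (innerSL ℝ (x - x₀)).comp (ContinuousLinearMap.id ℝ E))) x := by
    have hf : (fun y : E => ‖y - x₀‖ ^ 2 / 2) = fun y => (1 / 2 : ℝ) * ‖y - x₀‖ ^ 2 := by
      funext y; ring
    rw [hf]; exact h3
  have h5 : HasGradientAt (fun y : E => ‖y - x₀‖ ^ 2 / 2) (x - x₀) x := by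
    rw [hasGradientAt_iff_hasFDerivAt]
    refine h4.congr_fderiv ?_
    ext y
    simp only [smul_apply, ContinuousLinearMap.comp_apply, ContinuousLinearMap.id_apply,
      innerSL_apply_apply, InnerProductSpace.toDual_apply_apply, smul_eq_mul, nsmul_eq_mul]
    push_cast
    ring
  exact h5.gradient

/-- KERNEL: level 1 of the tower IS the loop momentum, `θ₁ = ⟪u, x − x₀⟫`, for every drift. -/
theorem radialJerk_one (u : ℝ → E → E) (x₀ : E) (t : ℝ) (x : E) :
    radialJerk u x₀ 1 t x = inner ℝ (u t x) (x - x₀) := by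
  have h0 : radialJerk u x₀ 0 t = fun y : E => ‖y - x₀‖ ^ 2 / 2 := rfl
  show deriv (fun s => radialJerk u x₀ 0 s x) t + inner ℝ (u t x) (gradient (radialJerk u x₀ 0 t) x)
      = inner ℝ (u t x) (x - x₀)
  rw [h0, gradient_radial]
  have : (fun s : ℝ => radialJerk u x₀ 0 s x) = fun _ => ‖x - x₀‖ ^ 2 / 2 := rfl
  rw [this, deriv_const]
  simp

/-- KERNEL: `τ = Sx × x` is tangent to the spheres. -/
theorem topField_tangent (a b c : ℝ) (x : E) : inner ℝ (topField a b c x) x = 0 := by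
  simp [topField, EuclideanSpace.inner_eq_star_dotProduct, dotProduct, Fin.sum_univ_three]
  ring

/-- KERNEL: `τ` passes level 1 of the strain tower: `⟪τ, Sx⟫ = 0`. -/
theorem topField_perp_strain (a b c : ℝ) (x : E) : inner ℝ (topField a b c x) (strain a b c x) = 0 := by
  simp [topField, strain, EuclideanSpace.inner_eq_star_dotProduct, dotProduct, Fin.sum_univ_three]
  ring

/-- KERNEL: level 2 of the inviscid strain tower does NOT vanish on `τ`:
`⟪τ, S²x⟫ = −(a−b)(b−c)(c−a)·x₀x₁x₂`. -/
theorem topField_dot_strainSq (a b c : ℝ) (x : E) :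
    inner ℝ (topField a b c x) (strain (a ^ 2) (b ^ 2) (c ^ 2) x)
      = -((a - b) * (b - c) * (c - a)) * (x 0 * x 1 * x 2) := by
  simp [topField, strain, EuclideanSpace.inner_eq_star_dotProduct, dotProduct, Fin.sum_univ_three]
  ring

/-- KERNEL: `⟪Sx, x⟫ = xᵀSx`. -/
theorem strain_dot_self (a b c : ℝ) (x : E) : inner ℝ (strain a b c x) x = quadForm a b c x := by
  simp [strain, quadForm, EuclideanSpace.inner_eq_star_dotProduct, dotProduct, Fin.sum_univ_three]
  ring

/-- KERNEL: in the steady strain drift the first radial jerk is the quadric `xᵀSx` (so its vortex-line integrals are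
`‖x‖²` and `xᵀSx`: vortex lines of any inviscid unthreaded shadow at a strain centre are POLHODES). -/
theorem radialJerk_one_strain (a b c t : ℝ) (x : E) :
    radialJerk (fun _ => strain a b c) 0 1 t x = quadForm a b c x := by
  rw [radialJerk_one, sub_zero, strain_dot_self]

/-- KERNEL (coordinate-free form of `vandermonde_closure`): a vector orthogonal to `x, Sx, S²x` at a point off the
principal planes of a triaxial strain is zero. -/
theorem strainTower_closure (a b c : ℝ) (x B : E) (hab : a ≠ b) (hbc : b ≠ c) (hca : c ≠ a)
    (hx0 : x 0 ≠ 0) (hx1 : x 1 ≠ 0) (hx2 : x 2 ≠ 0)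
    (h0 : inner ℝ B x = 0) (h1 : inner ℝ B (strain a b c x) = 0)
    (h2 : inner ℝ B (strain (a ^ 2) (b ^ 2) (c ^ 2) x) = 0) : B = 0 := by
  simp [strain, EuclideanSpace.inner_eq_star_dotProduct, dotProduct, Fin.sum_univ_three] at h0 h1 h2
  have key := vandermonde_closure a b c (x 0) (x 1) (x 2) (B 0) (B 1) (B 2) hab hbc hca hx0 hx1 hx2
    (by linarith) (by linarith) (by linarith)
  obtain ⟨k0, k1, k2⟩ := key
  ext i
  fin_cases i <;> simp_all

end Objects

/-! ## Part B — typed statements over the tree's vector calculus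

Conventions as in `KinematicShadowSketch.lean` (g6): `Literature.Analysis.FluidPDE.curl/cross`, Mathlib `gradient`,
`fderiv`, `deriv`, `Laplacian.laplacian`; smoothness as `ContDiffOn … (I ×ˢ U)` so every derivative written is
classical.  STATUS tags: THEOREM (paper proof in the card, kernel core in Part A) · CLASSICAL · CONJECTURE. -/

section Typed

/-- CLASSICAL (Ertel 1942; [corpus:acheson1990 p.125, Ex. 5.17]).  For a smooth incompressible Euler solution on an
open space-time set and ANY smooth scalar `θ`: `D_t ⟪ω, ∇θ⟫ = ⟪ω, ∇(D_t θ)⟫`.  Typed for reference; it is the engine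
of everything below.  (For Navier–Stokes: `(D_t − νΔ)⟪ω,∇θ⟫ = ⟪ω, ∇((D_t − νΔ)θ)⟫ − 2ν Σᵢⱼ ∂ᵢωⱼ ∂ᵢ∂ⱼθ`.) -/
def ErtelCommutation : Prop :=
  ∀ (v : ℝ → E → E) (p θ : ℝ → E → ℝ) (I : Set ℝ) (U : Set E), IsOpen I → IsOpen U →
    ContDiffOn ℝ (⊤ : ℕ∞) (Function.uncurry v) (I ×ˢ U) →
    ContDiffOn ℝ (⊤ : ℕ∞) (Function.uncurry p) (I ×ˢ U) →
    ContDiffOn ℝ (⊤ : ℕ∞) (Function.uncurry θ) (I ×ˢ U) →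
    (∀ t ∈ I, ∀ x ∈ U, deriv (fun s => v s x) t + fderiv ℝ (v t) x (v t x) + gradient (p t) x = 0) →
    (∀ t ∈ I, ∀ x ∈ U, Literature.Analysis.FluidPDE.VectorCalculus.divergence (v t) x = 0) →
    ∀ t ∈ I, ∀ x ∈ U,
      deriv (fun s => inner ℝ (Literature.Analysis.FluidPDE.curl (v s) x) (gradient (θ s) x)) t
        + inner ℝ (v t x)
            (gradient (fun z => inner ℝ (Literature.Analysis.FluidPDE.curl (v t) z) (gradient (θ t) z)) x)
      = inner ℝ (Literature.Analysis.FluidPDE.curl (v t) x)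
          (gradient (fun z => deriv (fun s => θ s z) t + inner ℝ (v t z) (gradient (θ t) z)) x)

/-- THEOREM (Euler, all levels; induction on `k` by `ErtelCommutation`, level 0 = the hypothesis).
INVISCID RADIAL-JERK TOWER: on a smooth incompressible Euler solution whose vortex lines are tangent to the spheres
about `x₀` on `I × U`, EVERY radial jerk `θ_k` is constant along vortex lines:
`⟪ω, ∇θ_k⟫ ≡ 0` for all `k`.  Hence `rank(∇θ₀, ∇θ₁, ∇θ₂, …) ≤ 2` on `{ω ≠ 0}`. -/
def InviscidRadialJerkTower : Prop :=
  ∀ (v : ℝ → E → E) (p : ℝ → E → ℝ) (x₀ : E) (I : Set ℝ) (U : Set E), IsOpen I → IsOpen U →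
    ContDiffOn ℝ (⊤ : ℕ∞) (Function.uncurry v) (I ×ˢ U) →
    ContDiffOn ℝ (⊤ : ℕ∞) (Function.uncurry p) (I ×ˢ U) →
    (∀ t ∈ I, ∀ x ∈ U, deriv (fun s => v s x) t + fderiv ℝ (v t) x (v t x) + gradient (p t) x = 0) →
    (∀ t ∈ I, ∀ x ∈ U, Literature.Analysis.FluidPDE.VectorCalculus.divergence (v t) x = 0) →
    (∀ t ∈ I, ∀ x ∈ U, inner ℝ (Literature.Analysis.FluidPDE.curl (v t) x) (x - x₀) = 0) →
    ∀ k : ℕ, ∀ t ∈ I, ∀ x ∈ U,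
      inner ℝ (Literature.Analysis.FluidPDE.curl (v t) x) (gradient (radialJerk v x₀ k t) x) = 0

/-- THEOREM (level 2 of the tower in closed form).  RADIAL BERNOULLI LAW: on an unthreaded incompressible Euler flow the
function `‖v‖² − ⟪x − x₀, ∇p⟫ = D_t⟪v, x − x₀⟫` is constant along vortex lines — the inviscid part of the
«order-two threading law» that the lineage found numerically on shells (g3), now for arbitrary smooth unthreaded Euler
data and with no expansion. -/
def EulerRadialBernoulli : Prop :=
  ∀ (v : ℝ → E → E) (p : ℝ → E → ℝ) (x₀ : E) (I : Set ℝ) (U : Set E), IsOpen I → IsOpen U →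
    ContDiffOn ℝ (⊤ : ℕ∞) (Function.uncurry v) (I ×ˢ U) →
    ContDiffOn ℝ (⊤ : ℕ∞) (Function.uncurry p) (I ×ˢ U) →
    (∀ t ∈ I, ∀ x ∈ U, deriv (fun s => v s x) t + fderiv ℝ (v t) x (v t x) + gradient (p t) x = 0) →
    (∀ t ∈ I, ∀ x ∈ U, Literature.Analysis.FluidPDE.VectorCalculus.divergence (v t) x = 0) →
    (∀ t ∈ I, ∀ x ∈ U, inner ℝ (Literature.Analysis.FluidPDE.curl (v t) x) (x - x₀) = 0) →
    ∀ t ∈ I, ∀ x ∈ U,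
      inner ℝ (Literature.Analysis.FluidPDE.curl (v t) x)
        (gradient (fun z => ‖v t z‖ ^ 2 - inner ℝ (z - x₀) (gradient (p t) z)) x) = 0

/-- THEOREM (pointwise corollary of levels 0–2).  Where `ω ≠ 0`, the first three radial jerk gradients are linearly
dependent: `det(x − x₀, ∇θ₁, ∇θ₂) = 0` — one scalar PDE-free identity every unthreaded Euler flow satisfies on
`{ω ≠ 0}` (and every NS flow satisfies up to the explicit viscous commutator of `ViscousLevelTwoLaw`). -/
def RadialJerkRankTwo : Prop :=
  ∀ (v : ℝ → E → E) (p : ℝ → E → ℝ) (x₀ : E) (I : Set ℝ) (U : Set E), IsOpen I → IsOpen U →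
    ContDiffOn ℝ (⊤ : ℕ∞) (Function.uncurry v) (I ×ˢ U) →
    ContDiffOn ℝ (⊤ : ℕ∞) (Function.uncurry p) (I ×ˢ U) →
    (∀ t ∈ I, ∀ x ∈ U, deriv (fun s => v s x) t + fderiv ℝ (v t) x (v t x) + gradient (p t) x = 0) →
    (∀ t ∈ I, ∀ x ∈ U, Literature.Analysis.FluidPDE.VectorCalculus.divergence (v t) x = 0) →
    (∀ t ∈ I, ∀ x ∈ U, inner ℝ (Literature.Analysis.FluidPDE.curl (v t) x) (x - x₀) = 0) →
    ∀ t ∈ I, ∀ x ∈ U, Literature.Analysis.FluidPDE.curl (v t) x ≠ 0 →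
      inner ℝ (x - x₀)
        (Literature.Analysis.FluidPDE.cross (gradient (radialJerk v x₀ 1 t) x)
          (gradient (radialJerk v x₀ 2 t) x)) = 0

/-- THEOREM (Navier–Stokes, ν = 1, level 2 with its commutator).  VISCOUS LEVEL-TWO LAW: for a smooth unthreaded NS flow
on `I × U`, with `m = ⟪v, x − x₀⟫`,
`⟪ω, ∇((∂ₜ + v·∇ − Δ) m)⟫ = 2 Σᵢⱼ ∂ᵢωⱼ ∂ᵢ∂ⱼ m`.
(Level 1 is clean because `∇²(½‖x−x₀‖²) = I` and `div ω = 0`; from level 2 on, viscosity turns the algebraic tower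
into differential constraints on `ω` — «viscosity relaxes rigidity into growth», cf. `StrainShadowClassification`.) -/
def ViscousLevelTwoLaw : Prop :=
  ∀ (v : ℝ → E → E) (p : ℝ → E → ℝ) (x₀ : E) (I : Set ℝ) (U : Set E), IsOpen I → IsOpen U →
    ContDiffOn ℝ (⊤ : ℕ∞) (Function.uncurry v) (I ×ˢ U) →
    ContDiffOn ℝ (⊤ : ℕ∞) (Function.uncurry p) (I ×ˢ U) →
    (∀ t ∈ I, ∀ x ∈ U, deriv (fun s => v s x) t + fderiv ℝ (v t) x (v t x) + gradient (p t) x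
        = Laplacian.laplacian (v t) x) →
    (∀ t ∈ I, ∀ x ∈ U, Literature.Analysis.FluidPDE.VectorCalculus.divergence (v t) x = 0) →
    (∀ t ∈ I, ∀ x ∈ U, inner ℝ (Literature.Analysis.FluidPDE.curl (v t) x) (x - x₀) = 0) →
    ∀ t ∈ I, ∀ x ∈ U,
      let m : ℝ → E → ℝ := fun s z => inner ℝ (v s z) (z - x₀)
      inner ℝ (Literature.Analysis.FluidPDE.curl (v t) x)
          (gradient (fun z => deriv (fun s => m s z) t + inner ℝ (v t z) (gradient (m t) z)
            - Laplacian.laplacian (m t) z) x)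
        = 2 * ∑ i : Fin 3, ∑ j : Fin 3,
            (fderiv ℝ (fun z => (Literature.Analysis.FluidPDE.curl (v t) z) j) x (EuclideanSpace.single i 1))
              * (fderiv ℝ (fun z => fderiv ℝ (m t) z (EuclideanSpace.single j 1)) x (EuclideanSpace.single i 1))

/-- THEOREM (inviscid kinematic rigidity, general drift; proof: frozen-field Ertel commutation
`D_t⟪B,∇θ⟫ = ⟪B, ∇D_tθ⟫` [corpus:majda2002 p.26, Lemma 1.4] for levels 0,1,2, then linear algebra where the three
gradients span, continuity elsewhere).  A field `B` FROZEN into a smooth drift `u` (`∂ₜB + (u·∇)B − (B·∇)u = 0`) and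
tangent to the spheres about `x₀` on `I × U` vanishes identically as soon as the drift's radial-jerk tower has full rank
on a dense subset of `U` at each time.  Neither incompressibility of `u` nor `div B = 0` is needed. -/
def InviscidKinematicRigidity : Prop :=
  ∀ (u B : ℝ → E → E) (x₀ : E) (I : Set ℝ) (U : Set E), IsOpen I → IsOpen U →
    ContDiffOn ℝ (⊤ : ℕ∞) (Function.uncurry u) (I ×ˢ U) →
    ContDiffOn ℝ (⊤ : ℕ∞) (Function.uncurry B) (I ×ˢ U) →
    (∀ t ∈ I, ∀ x ∈ U,
      deriv (fun s => B s x) t + fderiv ℝ (B t) x (u t x) - fderiv ℝ (u t) x (B t x) = 0) →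
    (∀ t ∈ I, ∀ x ∈ U, inner ℝ (B t x) (x - x₀) = 0) →
    (∀ t ∈ I, U ⊆ closure {x | x ∈ U ∧
        inner ℝ (x - x₀)
          (Literature.Analysis.FluidPDE.cross (gradient (radialJerk u x₀ 1 t) x)
            (gradient (radialJerk u x₀ 2 t) x)) ≠ 0}) →
    ∀ t ∈ I, ∀ x ∈ U, B t x = 0

/-- THEOREM (special case of `InviscidKinematicRigidity` with the kernel lemma `vandermonde_closure`: for `u = Sx` the
tower is `½‖x‖², xᵀSx, 2xᵀS²x`, whose gradients `x, 2Sx, 4S²x` span off the principal planes).  INVISCID STRAIN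
RIGIDITY: no non-zero field frozen into a TRIAXIAL linear strain stays tangent to the spheres about its centre on any
open space-time set — for every triple of pairwise distinct principal strains, incompressible or not. -/
def InviscidStrainRigidity : Prop :=
  ∀ (a b c : ℝ) (B : ℝ → E → E) (I : Set ℝ) (U : Set E), a ≠ b → b ≠ c → c ≠ a → IsOpen I → IsOpen U →
    ContDiffOn ℝ (⊤ : ℕ∞) (Function.uncurry B) (I ×ˢ U) →
    (∀ t ∈ I, ∀ x ∈ U,
      deriv (fun s => B s x) t + fderiv ℝ (B t) x (strain a b c x) - strain a b c (B t x) = 0) →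
    (∀ t ∈ I, ∀ x ∈ U, inner ℝ (B t x) x = 0) →
    ∀ t ∈ I, ∀ x ∈ U, B t x = 0

/-- THEOREM (paper proof in the card, §P3; kernel skeleton `dTau_strain`, `survivor_balance`, `tau_dot_S2x`).
VISCOUS STRAIN-SHADOW CLASSIFICATION: let `ν > 0` and `S = diag(a,b,c)` be trace-free with pairwise distinct entries.
Every smooth divergence-free solution of the passive viscous vector equation `∂ₜB + (Sx·∇)B − SB = νΔB` on a connected
open space-time set `I × U` that is tangent to the spheres about the centre is
`B(t,x) = C · exp(xᵀSx / 2ν) · (Sx × x)` for one constant `C`.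
In particular the solution space is ONE-dimensional, consists of STEADY fields, none of them axisymmetric, all of them
Gaussian-growing along every extensional principal axis.  Proof chain: `f = ⟪B,x⟫ ≡ 0 ⇒ g = ⟪B,Sx⟫ ≡ 0 ⇒
⟪B,S²x⟫ = ν div(SB)` (the transport equations of `f` and `g`), then `B = σ·(Sx × x)` with `∇σ ⊥ τ`, the last identity
forces `σ = exp(xᵀSx/2ν)·h(‖x‖², t)`, and the `τ`-component of the equation reads
`hₜ − (xᵀSx) h₁ − 7ν h₁ − ν‖x‖² h₁₁ = 0`, whence `h₁ = 0 = hₜ`; globalisation by continuity across the principal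
planes (V21-P2, see `StrainShadowClassificationLocal`; v1.0 said «analyticity in x» — not needed). -/
def StrainShadowClassification : Prop :=
  ∀ (ν a b c : ℝ) (B : ℝ → E → E) (I : Set ℝ) (U : Set E), 0 < ν → a ≠ b → b ≠ c → c ≠ a → a + b + c = 0 →
    IsOpen I → IsPreconnected I → IsOpen U → IsPreconnected U →
    ContDiffOn ℝ (⊤ : ℕ∞) (Function.uncurry B) (I ×ˢ U) →
    (∀ t ∈ I, ∀ x ∈ U, Literature.Analysis.FluidPDE.VectorCalculus.divergence (B t) x = 0) →
    (∀ t ∈ I, ∀ x ∈ U,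
      deriv (fun s => B s x) t + fderiv ℝ (B t) x (strain a b c x) - strain a b c (B t x)
        = ν • Laplacian.laplacian (B t) x) →
    (∀ t ∈ I, ∀ x ∈ U, inner ℝ (B t x) x = 0) →
    ∃ C : ℝ, ∀ t ∈ I, ∀ x ∈ U, B t x = (C * Real.exp (quadForm a b c x / (2 * ν))) • topField a b c x

/-- THEOREM (M rung, V21-P2; the global statement above is its corollary).  LOCAL STRAIN-SHADOW CLASSIFICATION OFF THE
PRINCIPAL PLANES: the same conclusion on an open preconnected `U` avoiding the three principal planes `{xᵢ = 0}` — there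
`(★) ⟪Sx, S²x × x⟫ = V·x₁x₂x₃ ≠ 0` and `τ = Sx × x ≠ 0` everywhere, so `σ = B/τ` is a globally defined smooth scalar on
`U`, the two transport identities give `σ = exp(xᵀSx/2ν)·k` with `∇k ∥ x`, and the `τ`-component ODE forces `k`
constant; NO analyticity and no gluing are needed.  (Globalisation to a general connected `U`, V21-P2: `k` is locally
constant on `U ∖ ⋃{xᵢ = 0}`, `τ ≠ 0` on the planes off the axes, continuity of `B` across the planes and connectedness
of `U` glue the octant constants — replaces the «analytic in x» sentence of v1.0.) -/
def StrainShadowClassificationLocal : Prop :=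
  ∀ (ν a b c : ℝ) (B : ℝ → E → E) (I : Set ℝ) (U : Set E), 0 < ν → a ≠ b → b ≠ c → c ≠ a → a + b + c = 0 →
    IsOpen I → IsPreconnected I → IsOpen U → IsPreconnected U →
    U ⊆ {x | x 0 ≠ 0 ∧ x 1 ≠ 0 ∧ x 2 ≠ 0} →
    ContDiffOn ℝ (⊤ : ℕ∞) (Function.uncurry B) (I ×ˢ U) →
    (∀ t ∈ I, ∀ x ∈ U, Literature.Analysis.FluidPDE.VectorCalculus.divergence (B t) x = 0) →
    (∀ t ∈ I, ∀ x ∈ U,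
      deriv (fun s => B s x) t + fderiv ℝ (B t) x (strain a b c x) - strain a b c (B t x)
        = ν • Laplacian.laplacian (B t) x) →
    (∀ t ∈ I, ∀ x ∈ U, inner ℝ (B t x) x = 0) →
    ∃ C : ℝ, ∀ t ∈ I, ∀ x ∈ U, B t x = (C * Real.exp (quadForm a b c x / (2 * ν))) • topField a b c x

/-- Kernel: the global classification implies the local one (specialise `U`). -/
theorem strainShadowClassificationLocal_of (h : StrainShadowClassification) : StrainShadowClassificationLocal :=
  fun ν a b c B I U hν hab hbc hca htr hI hIc hU hUc _ hsm hdiv heq htan =>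
    h ν a b c B I U hν hab hbc hca htr hI hIc hU hUc hsm hdiv heq htan

/-- THEOREM (corollary).  STRAIN-SHADOW LIOUVILLE: in the bounded class the viscous strain shadow is empty — a bounded
smooth divergence-free sphere-tangent solution of the passive viscous equation in a trace-free triaxial strain on
`I × ℝ³` (`I` any open interval, e.g. `(−∞,0)`) vanishes identically.  This is the linear shadow of the wall at a
triaxial stagnation centre, DECIDED; boundedness is load-bearing (next item). -/
def StrainShadowLiouville : Prop :=
  ∀ (ν a b c : ℝ) (B : ℝ → E → E) (I : Set ℝ), 0 < ν → a ≠ b → b ≠ c → c ≠ a → a + b + c = 0 →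
    IsOpen I → IsPreconnected I →
    ContDiffOn ℝ (⊤ : ℕ∞) (Function.uncurry B) (I ×ˢ Set.univ) →
    (∀ t ∈ I, ∀ x, Literature.Analysis.FluidPDE.VectorCalculus.divergence (B t) x = 0) →
    (∀ t ∈ I, ∀ x,
      deriv (fun s => B s x) t + fderiv ℝ (B t) x (strain a b c x) - strain a b c (B t x)
        = ν • Laplacian.laplacian (B t) x) →
    (∀ t ∈ I, ∀ x, inner ℝ (B t x) x = 0) →
    (∃ C : ℝ, ∀ t ∈ I, ∀ x, ‖B t x‖ ≤ C) →
    ∀ t ∈ I, ∀ x, B t x = 0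

/-- THEOREM (direct calculus; algebraic skeleton kernel-checked in Part A).  THE SURVIVOR — `false-without-bounded` for the
strain shadow: `B⋆(x) = exp(xᵀSx/2ν)·(Sx × x)` is a smooth, steady, divergence-free, sphere-tangent, NON-ZERO solution
of the passive viscous equation in the strain `Sx` on all of `ℝ³` (unbounded: `‖B⋆(0,s,s)‖ = |b−c| s² e^{−a s²/2ν}` with
`a < 0` the compressive rate).  So already in the linear shadow nothing short of the boundedness hypothesis of
`PoloidalLiouville` excludes unthreaded configurations. -/
def StrainShadowSurvivor : Prop :=
  ∀ (ν a b c : ℝ), 0 < ν → a + b + c = 0 →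
    let Bs : E → E := fun x => Real.exp (quadForm a b c x / (2 * ν)) • topField a b c x
    (∀ x, fderiv ℝ Bs x (strain a b c x) - strain a b c (Bs x) = ν • Laplacian.laplacian Bs x) ∧
    (∀ x, Literature.Analysis.FluidPDE.VectorCalculus.divergence Bs x = 0) ∧
    (∀ x, inner ℝ (Bs x) x = 0) ∧
    (a ≠ b ∨ b ≠ c ∨ c ≠ a → ∃ x, Bs x ≠ 0)

/-- CONJECTURE (typed target; quadratic level = `vandermonde_closure`, cubic test case `h = x₁x₂x₃` has full rank).
POTENTIAL JERK RIGIDITY: a harmonic function near `x₀` whose radial-jerk tower (drift `u = ∇h`, steady) has rank ≤ 2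
everywhere is axisymmetric about a line through `x₀`.  Together with `InviscidKinematicRigidity` it DECIDES the
inviscid linearised local wall (W2) about every potential background: either the background is axisymmetric about an
axis through the centre, or no frozen sphere-tangent field exists near the centre. -/
def PotentialJerkRigidity : Prop :=
  ∀ (h : E → ℝ) (x₀ : E) (R : ℝ), 0 < R → ContDiffOn ℝ (⊤ : ℕ∞) h (Metric.ball x₀ R) →
    (∀ x ∈ Metric.ball x₀ R, Laplacian.laplacian h x = 0) →
    (let θ : ℕ → E → ℝ := fun k => radialJerk (fun _ z => gradient h z) x₀ k 0
     ∀ j k l : ℕ, ∀ x ∈ Metric.ball x₀ R,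
      inner ℝ (gradient (θ j) x) (Literature.Analysis.FluidPDE.cross (gradient (θ k) x) (gradient (θ l) x)) = 0) →
    ∃ e : E, e ≠ 0 ∧ ∀ x ∈ Metric.ball x₀ R, fderiv ℝ h x (Literature.Analysis.FluidPDE.cross e (x - x₀)) = 0

end Typed

/-! ## Part C — relation to the wall (booking, honest)

* `PoloidalLiouville` ⟨1222⟩, `stub_scalarLiouville` (W1) and `UnthreadedRigidity` ⟨27585⟩ (W2) are OPEN; NS regularity is
  NOT proved.  Nothing here implies them: the decided statements live in the INVISCID and LINEAR (passive-vector) shadows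
  of the wall and in the list of exact NECESSARY CONDITIONS (`InviscidRadialJerkTower`, `EulerRadialBernoulli`,
  `RadialJerkRankTwo`, `ViscousLevelTwoLaw`) that every unthreaded flow satisfies.  W1 movement: 0.
* What the tower adds to the wall's dossier: (i) the closed-form GENERATOR of the order-by-order threading laws (g3 found
  orders one and two numerically on shells; here: level k of Ertel's tower, with the viscous commutator from level 2 on);
  (ii) the Euler-vs-NS split asked for on the wall board: inertia ALONE is algebraically rigid at every triaxial strain
  centre and about every generic drift (`InviscidStrainRigidity`, `InviscidKinematicRigidity`), viscosity ALONE admits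
  exactly one local survivor per strain centre and it is unbounded (`StrainShadowClassification`); (iii) a
  `false-without-bounded` witness in the LINEAR STRAIN SHADOW (`StrainShadowSurvivor`) — V21-P1 booking: the first
  disproof-STYLE witness IN THE LINEAR SHADOW (prescribed unbounded drift `Sx`; `B⋆` is NOT the curl of a bounded NS
  velocity); it is NOT a Disproof/`Negative/` entry for ⟨1222⟩ — such an entry must negate a hypothesis-dropped variant of
  `PoloidalLiouville` itself.
* V21-P4 scope: «the inviscid linearised W2 wall is DECIDED about triaxial strain centres» means decided for the
  FROZEN-FIELD equation in the background `Sx` (the kinematics of the linearisation), NOT a statement about ⟨27585⟩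
  `UnthreadedRigidity` itself, which stays OPEN.
* v1.1 (2026-08-29, V21 PASS-WITH-PRICE paid): P1/P4 words above; P2 `StrainShadowClassificationLocal` typed (M rung) and
  globalisation by continuity; P3 lint (`ContinuousLinearMap.smul_apply` → `smul_apply`) and the landing
  order Part A → `Theorems/…ErtelTowerAlgebra.lean` (S) → `contDiffOn_radialJerk` → `InviscidStrainRigidity` by name;
  `ViscousLevelTwoLaw` to get a Defs twin before a proof (by-name hygiene).
-/

end Summit.NavierStokesRegularity.NavierStokesRegularity.Cruxes.PoloidalLiouville.ErtelTower
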